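import Literature.Probability.LatticeModels.GibbsSpecificationTilted
import HarnessLib

/-!
# The one-site DLR equations characterise the Gibbs measures of a positive Gibbsian specification (Georgii, Thm. 1.33)

Fourth companion file of `GibbsSpecification.lean` on the Gibbsian kernels with an a priori measure
`γ_Λ(· | η) = ((Measure.pi fun _ : Λ => ν).map (glueWith Λ · η)).tilted (φ Λ)` (the shape of
`gibbsSpecOfPotential`, of the O(N) kernels and of the lattice Yang–Mills `ymSpecification`;
`GibbsSpecificationTilted.lean` proves they form a specification). Theorems only.

* `isGibbsMeasure_tilted_of_singleton` — **Georgii's Theorem 1.33**: for a nonzero finite `ν` and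
  bounded measurable energies `φ_Λ` with `φ_{Λ'} - φ_Λ` not depending on the spins in `Λ ⊆ Λ'`, a
  probability measure with `μ γ_{x} = μ` for every SINGLE site `x` satisfies `μ γ_Λ = μ` for every
  finite `Λ` (Georgii 2011, Thm. 1.33: for a `λ`-specification with everywhere positive densities
  `𝒢(γ) = {μ : μ γ_i = μ ∀ i}`; positivity of `e^{φ_Λ}` is automatic here and cannot be dropped in
  general, loc. cit.); `dlr_insert_tilted` is the induction step `Δ → Δ ∪ {i}`;
* `isGibbsMeasure_gibbsSpecOfPotential_of_singleton` (`_iff_singleton`) — the same for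
  `gibbsSpecOfPotential ν Φ supp β` (bounded, finitely supported, adapted potential; Def. 2.9).

Proof: with `J_Λ F = ∫⋯∫⁻_Λ F ∂ν` (Mathlib `lmarginal`), `E = e^{φ_{Λ'}}`, `Λ' = Δ ∪ {i}`, locality
makes every sub-volume kernel a ratio of marginals of the SAME factor, `γ_Δ F = J_Δ(E F)/J_Δ E`
(`lintegral_tilted_eq_of_subset`); with `G = γ_Δ 1_A`, `r = (J_Δ E · J_{i} E / J_{Λ'} E) / E`,
pulling fibre-constant factors out (`lmarginal_mul_of_dependsOn_left`) and Tonelli give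
`γ_{i}(r G) = γ_{Λ'} 1_A`, `γ_Δ(r G) = G`, whence `μ(γ_{Λ'} 1_A) = μ(r G) = μ(G) = μ(A)` — a direct
computation in place of Georgii's (1.31)–(1.32).

References: H.-O. Georgii, *Gibbs Measures and Phase Transitions*, 2nd ed. (2011), Thm. 1.33,
Rem. 1.24, Def. 2.9; S. Friedli, Y. Velenik (CUP 2017), §6.10.1 (6.110)–(6.111).
-/
noncomputable section

open MeasureTheory Finset Function
open scoped ENNReal

namespace Literature.Probability.LatticeModels

variable {V S : Type*} [MeasurableSpace S] [DecidableEq V]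

/-! ### Marginals: pulling out fibre-constant factors -/

/-- A factor not depending on the spins in `Λ` comes out of the `Λ`-marginal on the left:
`∫⋯∫⁻_Λ (g F) = g · ∫⋯∫⁻_Λ F` (Tonelli for the product reference measure; Georgii 2011, proof of
Thm. 1.33, properness of `λ`-kernels). Stated for a general family of a priori measures; the
homogeneous case `fun _ => ν` is `lmarginal_mul_left_of_dependsOn` of `ONModelSpecification.lean`
(not imported, to keep this file model-free). [cite: Georgii2011, Thm. 1.33] -/
theorem lmarginal_mul_of_dependsOn_left (μ : V → Measure S) (Λ : Finset V)
    {g F : (V → S) → ℝ≥0∞} (hg : DependsOn g ((↑Λ : Set V)ᶜ)) (hF : Measurable F) (x : V → S) :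
    lmarginal μ Λ (fun σ => g σ * F σ) x = g x * lmarginal μ Λ F x := by
  have hfib : ∀ y : ↥Λ → S, g (updateFinset x Λ y) = g x := fun y =>
    hg fun i hi => by
      simp only [Set.mem_compl_iff, Finset.mem_coe] at hi
      simp [updateFinset, hi]
  simp only [lmarginal]
  simp_rw [hfib]
  exact lintegral_const_mul (g x) (hF.comp measurable_updateFinset)

/-- A factor not depending on the spins in `Λ` comes out of the `Λ`-marginal on the right:
`∫⋯∫⁻_Λ (F g) = (∫⋯∫⁻_Λ F) · g` (Georgii 2011, proof of Thm. 1.33). [cite: Georgii2011, Thm. 1.33] -/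
theorem lmarginal_mul_of_dependsOn_right (μ : V → Measure S) (Λ : Finset V)
    {g F : (V → S) → ℝ≥0∞} (hg : DependsOn g ((↑Λ : Set V)ᶜ)) (hF : Measurable F) (x : V → S) :
    lmarginal μ Λ (fun σ => F σ * g σ) x = lmarginal μ Λ F x * g x := by
  simp_rw [mul_comm (F _) (g _)]
  rw [lmarginal_mul_of_dependsOn_left μ Λ hg hF x, mul_comm]

/-- A `Λ`-marginal does not depend on the spins in `Λ` (Mathlib `lmarginal_congr`; Georgii 2011,
Def. 1.23 (ii)). [cite: Georgii2011, Thm. 1.33] -/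
theorem dependsOn_compl_lmarginal (μ : V → Measure S) (Λ : Finset V) (F : (V → S) → ℝ≥0∞) :
    DependsOn (lmarginal μ Λ F) ((↑Λ : Set V)ᶜ) := fun _ _ h =>
  lmarginal_congr μ F fun i hi => h i (by simpa using hi)

/-! ### Sub-volume kernels with the Boltzmann factor of the larger volume -/

/-- **A sub-volume kernel as a ratio of marginals of the LARGER volume's Boltzmann factor**: if
`Δ ⊆ Λ'` and `φ_{Λ'} - φ_Δ` does not depend on the spins in `Δ`, then for measurable `F ≥ 0`
`∫ F dγ_Δ(· | η) = (∫⋯∫⁻_Δ e^{φ_{Λ'}} F)(η) / (∫⋯∫⁻_Δ e^{φ_{Λ'}})(η)` — the fibre-constant factor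
`e^{φ_{Λ'} - φ_Δ}` cancels (Georgii 2011, (1.28)/(1.31): the kernels of a `λ`-specification are the
conditional distributions of the larger kernel). [cite: Georgii2011, Thm. 1.33] -/
theorem lintegral_tilted_eq_of_subset (ν : Measure S) [IsFiniteMeasure ν] [NeZero ν]
    {φ : Finset V → (V → S) → ℝ} (hφm : ∀ Λ, Measurable (φ Λ))
    (hφb : ∀ Λ, ∃ C, ∀ σ, |φ Λ σ| ≤ C) {Δ Λ' : Finset V}
    (hloc : DependsOn (fun σ => φ Λ' σ - φ Δ σ) ((↑Δ : Set V)ᶜ)) (η : V → S)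
    {F : (V → S) → ℝ≥0∞} (hF : Measurable F) :
    ∫⁻ σ, F σ ∂(((Measure.pi fun _ : Δ => ν).map (glueWith Δ · η)).tilted (φ Δ)) =
      lmarginal (fun _ : V => ν) Δ (fun σ => ENNReal.ofReal (Real.exp (φ Λ' σ)) * F σ) η /
        lmarginal (fun _ : V => ν) Δ (fun σ => ENNReal.ofReal (Real.exp (φ Λ' σ))) η := by
  rw [lintegral_tilted_map_glueWith_pi ν Δ η (hφm Δ) (hφb Δ) hF]
  have hw : Measurable fun σ : V → S => ENNReal.ofReal (Real.exp (φ Δ σ)) :=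
    (hφm Δ).exp.ennreal_ofReal
  have hsplit : ∀ σ : V → S, ENNReal.ofReal (Real.exp (φ Λ' σ)) =
      ENNReal.ofReal (Real.exp (φ Λ' σ - φ Δ σ)) * ENNReal.ofReal (Real.exp (φ Δ σ)) := fun σ => by
    rw [← ENNReal.ofReal_mul (Real.exp_pos _).le, ← Real.exp_add, sub_add_cancel]
  have hD : DependsOn (fun σ : V → S => ENNReal.ofReal (Real.exp (φ Λ' σ - φ Δ σ)))
      ((↑Δ : Set V)ᶜ) := fun x y hxy => by
    have h := hloc hxy
    simp only at h
    show ENNReal.ofReal (Real.exp (φ Λ' x - φ Δ x)) = ENNReal.ofReal (Real.exp (φ Λ' y - φ Δ y))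
    rw [h]
  have hD0 : ENNReal.ofReal (Real.exp (φ Λ' η - φ Δ η)) ≠ 0 :=
    ENNReal.ofReal_ne_zero_iff.2 (Real.exp_pos _)
  simp_rw [hsplit, mul_assoc]
  rw [lmarginal_mul_of_dependsOn_left _ Δ
      (F := fun σ => ENNReal.ofReal (Real.exp (φ Δ σ)) * F σ) hD (hw.fun_mul hF) η,
    lmarginal_mul_of_dependsOn_left _ Δ (F := fun σ => ENNReal.ofReal (Real.exp (φ Δ σ))) hD hw η,
    ENNReal.mul_div_mul_left _ _ hD0 ENNReal.ofReal_ne_top]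

/-- The set form of `lintegral_tilted_eq_of_subset`: `γ_Δ(A | η) = (∫⋯∫⁻_Δ e^{φ_{Λ'}} 1_A)(η) /
(∫⋯∫⁻_Δ e^{φ_{Λ'}})(η)` for `Δ ⊆ Λ'` (Georgii 2011, (1.28)/(1.31)). [cite: Georgii2011, Thm. 1.33] -/
theorem tilted_apply_eq_of_subset (ν : Measure S) [IsFiniteMeasure ν] [NeZero ν]
    {φ : Finset V → (V → S) → ℝ} (hφm : ∀ Λ, Measurable (φ Λ))
    (hφb : ∀ Λ, ∃ C, ∀ σ, |φ Λ σ| ≤ C) {Δ Λ' : Finset V}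
    (hloc : DependsOn (fun σ => φ Λ' σ - φ Δ σ) ((↑Δ : Set V)ᶜ)) (η : V → S)
    {A : Set (V → S)} (hA : MeasurableSet A) :
    ((Measure.pi fun _ : Δ => ν).map (glueWith Δ · η)).tilted (φ Δ) A =
      lmarginal (fun _ : V => ν) Δ
          (fun σ => ENNReal.ofReal (Real.exp (φ Λ' σ)) * A.indicator 1 σ) η /
        lmarginal (fun _ : V => ν) Δ (fun σ => ENNReal.ofReal (Real.exp (φ Λ' σ))) η := by
  rw [← lintegral_indicator_one hA,
    lintegral_tilted_eq_of_subset ν hφm hφb hloc η (measurable_one.indicator hA)]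

omit [DecidableEq V] in
/-- **The DLR equation for observables from the DLR equation for events** (kernel form): if
`η ↦ κ(A | η)` is measurable and `∫ κ(A | η) dμ(η) = μ(A)` for every measurable `A`, then
`∫ (∫ f dκ(· | η)) dμ(η) = ∫ f dμ` for measurable `f ≥ 0` (`μ.bind κ = μ`, Mathlib
`Measure.lintegral_bind`; Georgii 2011, Rem. 1.24). [cite: Georgii2011, Rem. 1.24] -/
theorem lintegral_lintegral_eq_of_forall_apply {κ : (V → S) → Measure (V → S)}
    {μ : Measure (V → S)}
    (hmeas : ∀ A : Set (V → S), MeasurableSet A → Measurable fun η => κ η A)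
    (hDLR : ∀ A : Set (V → S), MeasurableSet A → ∫⁻ η, κ η A ∂μ = μ A)
    {f : (V → S) → ℝ≥0∞} (hf : Measurable f) :
    ∫⁻ η, ∫⁻ σ, f σ ∂(κ η) ∂μ = ∫⁻ σ, f σ ∂μ := by
  have hκ : Measurable κ := Measure.measurable_of_measurable_coe _ hmeas
  have hbind : μ.bind κ = μ := by
    ext A hA
    rw [Measure.bind_apply hA hκ.aemeasurable]
    exact hDLR A hA
  rw [← Measure.lintegral_bind hκ.aemeasurable (hbind.symm ▸ hf.aemeasurable), hbind]

/-! ### The induction step -/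

section Step

variable (ν : Measure S) [IsFiniteMeasure ν] [NeZero ν] {φ : Finset V → (V → S) → ℝ}

/-- Two pointwise regroupings of the weight `r = (a b / z) / e` used in the induction step
(elementary `ℝ≥0∞` algebra). [cite: Georgii2011, Thm. 1.33] -/
theorem weight_regroup {e a b z G : ℝ≥0∞} (he0 : e ≠ 0) (het : e ≠ ∞) :
    e * ((a * b / z) / e * G) = (a * G) * (b / z) ∧ e * ((a * b / z) / e * G) = b * (a * G / z) := by
  have h : e * ((a * b / z) / e * G) = (a * b / z) * G := by
    rw [← mul_assoc, ENNReal.mul_div_cancel he0 het]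
  refine ⟨?_, ?_⟩ <;> rw [h] <;> simp only [div_eq_mul_inv] <;> ring

/-- **The induction step of Georgii's Theorem 1.33** for the Gibbsian kernels with an a priori
measure: if `μ γ_Δ = μ` and `μ γ_{i} = μ` with `i ∉ Δ`, then `μ γ_{insert i Δ} = μ` (set form of the
DLR equations). Proof: with `E = e^{φ_{Λ'}}`, `G = γ_Δ(A | ·)` and
`r = (∫⋯∫⁻_Δ E · ∫⋯∫⁻_{i} E / ∫⋯∫⁻_{Λ'} E) / E`, one has `γ_{i}(r G) = γ_{Λ'}(A | ·)` and
`γ_Δ(r G) = G`, so `μ(γ_{Λ'} A) = μ(r G) = μ(G) = μ(A)`. [cite: Georgii2011, Thm. 1.33] -/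
theorem dlr_insert_tilted (hφm : ∀ Λ, Measurable (φ Λ)) (hφb : ∀ Λ, ∃ C, ∀ σ, |φ Λ σ| ≤ C)
    (hloc : ∀ ⦃Λ Λ' : Finset V⦄, Λ ⊆ Λ' → DependsOn (fun σ => φ Λ' σ - φ Λ σ) ((↑Λ : Set V)ᶜ))
    {μ : Measure (V → S)} {Δ : Finset V} {i : V} (hi : i ∉ Δ)
    (hΔ : ∀ A : Set (V → S), MeasurableSet A →
      ∫⁻ η, ((Measure.pi fun _ : Δ => ν).map (glueWith Δ · η)).tilted (φ Δ) A ∂μ = μ A)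
    (hone : ∀ A : Set (V → S), MeasurableSet A →
      ∫⁻ η, ((Measure.pi fun _ : ({i} : Finset V) => ν).map (glueWith {i} · η)).tilted (φ {i}) A ∂μ
        = μ A)
    {A : Set (V → S)} (hA : MeasurableSet A) :
    ∫⁻ η, ((Measure.pi fun _ : ↥(insert i Δ) => ν).map (glueWith (insert i Δ) · η)).tilted
        (φ (insert i Δ)) A ∂μ = μ A := by
  -- the Boltzmann factor of the big volume `Λ' = insert i Δ`
  obtain ⟨E, hE⟩ : ∃ E : (V → S) → ℝ≥0∞,
      E = fun σ => ENNReal.ofReal (Real.exp (φ (insert i Δ) σ)) := ⟨_, rfl⟩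
  have hEm : Measurable E := hE ▸ (hφm _).exp.ennreal_ofReal
  have hE0 : ∀ σ, E σ ≠ 0 := fun σ => by
    rw [hE]; exact ENNReal.ofReal_ne_zero_iff.2 (Real.exp_pos _)
  have hEt : ∀ σ, E σ ≠ ∞ := fun σ => by rw [hE]; exact ENNReal.ofReal_ne_top
  have hind : Measurable (A.indicator (1 : (V → S) → ℝ≥0∞)) := measurable_one.indicator hA
  -- marginals of `E` are positive and finite
  have hJ0 : ∀ (Λ : Finset V) (σ : V → S), lmarginal (fun _ : V => ν) Λ E σ ≠ 0 := fun Λ σ => by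
    rw [hE]; exact lmarginal_ofReal_exp_ne_zero ν Λ σ (hφm _) (hφb _)
  have hJt : ∀ (Λ : Finset V) (σ : V → S), lmarginal (fun _ : V => ν) Λ E σ ≠ ∞ := fun Λ σ => by
    rw [hE]; exact lmarginal_ofReal_exp_ne_top ν Λ σ (hφm _) (hφb _)
  have hJm : ∀ Λ : Finset V, Measurable (lmarginal (fun _ : V => ν) Λ E) := fun Λ =>
    hEm.lmarginal _
  -- the sub-volume kernels with the big Boltzmann factor
  have hsubΔ : Δ ⊆ insert i Δ := Finset.subset_insert i Δ
  have hsubi : ({i} : Finset V) ⊆ insert i Δ :=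
    Finset.singleton_subset_iff.2 (Finset.mem_insert_self i Δ)
  have hKΔ : ∀ (η : V → S) {F : (V → S) → ℝ≥0∞}, Measurable F →
      ∫⁻ σ, F σ ∂(((Measure.pi fun _ : Δ => ν).map (glueWith Δ · η)).tilted (φ Δ)) =
        lmarginal (fun _ : V => ν) Δ (fun σ => E σ * F σ) η /
          lmarginal (fun _ : V => ν) Δ E η := fun η F hF => by
    rw [hE]; exact lintegral_tilted_eq_of_subset ν hφm hφb (hloc hsubΔ) η hF
  have hKi : ∀ (η : V → S) {F : (V → S) → ℝ≥0∞}, Measurable F →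
      ∫⁻ σ, F σ ∂(((Measure.pi fun _ : ({i} : Finset V) => ν).map (glueWith {i} · η)).tilted
          (φ {i})) =
        lmarginal (fun _ : V => ν) {i} (fun σ => E σ * F σ) η /
          lmarginal (fun _ : V => ν) {i} E η := fun η F hF => by
    rw [hE]; exact lintegral_tilted_eq_of_subset ν hφm hφb (hloc hsubi) η hF
  -- `G = γ_Δ(A | ·)` and its marginal form
  obtain ⟨G, hG⟩ : ∃ G : (V → S) → ℝ≥0∞,
      G = fun η => ((Measure.pi fun _ : Δ => ν).map (glueWith Δ · η)).tilted (φ Δ) A := ⟨_, rfl⟩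
  have hGeq : ∀ η, G η = lmarginal (fun _ : V => ν) Δ (fun σ => E σ * A.indicator 1 σ) η /
      lmarginal (fun _ : V => ν) Δ E η := fun η => by
    rw [hG]
    show ((Measure.pi fun _ : Δ => ν).map (glueWith Δ · η)).tilted (φ Δ) A = _
    rw [← lintegral_indicator_one hA, hKΔ η hind]
  have hGm : Measurable G := by
    rw [funext hGeq]; exact ((hEm.fun_mul hind).lmarginal _).div (hJm Δ)
  have hGdep : DependsOn G ((↑Δ : Set V)ᶜ) := by
    rw [funext hGeq]
    intro x y hxy
    show _ / _ = _ / _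
    rw [dependsOn_compl_lmarginal (fun _ : V => ν) Δ _ hxy, dependsOn_compl_lmarginal (fun _ : V => ν) Δ E hxy]
  -- `∫⋯∫⁻_Δ E · G = ∫⋯∫⁻_Δ (E 1_A)`
  have hJG : ∀ σ, lmarginal (fun _ : V => ν) Δ E σ * G σ =
      lmarginal (fun _ : V => ν) Δ (fun τ => E τ * A.indicator 1 τ) σ := fun σ => by
    rw [hGeq, ENNReal.mul_div_cancel (hJ0 Δ σ) (hJt Δ σ)]
  -- the weight `r`
  obtain ⟨r, hr⟩ : ∃ r : (V → S) → ℝ≥0∞, r = fun σ =>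
      (lmarginal (fun _ : V => ν) Δ E σ * lmarginal (fun _ : V => ν) {i} E σ /
        lmarginal (fun _ : V => ν) (insert i Δ) E σ) / E σ := ⟨_, rfl⟩
  have hrm : Measurable r := hr ▸ (((hJm Δ).mul (hJm {i})).div (hJm _)).div hEm
  have hrGm : Measurable fun σ => r σ * G σ := hrm.fun_mul hGm
  -- Tonelli: `J_{i} J_Δ = J_{Λ'} = J_Δ J_{i}`
  have hdisj : Disjoint ({i} : Finset V) Δ := Finset.disjoint_singleton_left.2 hi
  have hunion₁ : ∀ {F : (V → S) → ℝ≥0∞}, Measurable F →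
      lmarginal (fun _ : V => ν) {i} (lmarginal (fun _ : V => ν) Δ F) =
        lmarginal (fun _ : V => ν) (insert i Δ) F := fun hF => by
    rw [Finset.insert_eq, lmarginal_union _ _ hF hdisj]
  have hunion₂ : ∀ {F : (V → S) → ℝ≥0∞}, Measurable F →
      lmarginal (fun _ : V => ν) Δ (lmarginal (fun _ : V => ν) {i} F) =
        lmarginal (fun _ : V => ν) (insert i Δ) F := fun hF => by
    rw [Finset.insert_eq, lmarginal_union' _ _ hF hdisj]
  -- (a) `γ_{i}(r G)(η) = γ_{Λ'}(A | η)`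
  have ha : ∀ η, ∫⁻ σ, r σ * G σ ∂(((Measure.pi fun _ : ({i} : Finset V) => ν).map
      (glueWith {i} · η)).tilted (φ {i})) =
      lmarginal (fun _ : V => ν) (insert i Δ) (fun σ => E σ * A.indicator 1 σ) η /
        lmarginal (fun _ : V => ν) (insert i Δ) E η := fun η => by
    rw [hKi η hrGm]
    have hpt : ∀ σ, E σ * (r σ * G σ) =
        lmarginal (fun _ : V => ν) Δ (fun τ => E τ * A.indicator 1 τ) σ *
          (lmarginal (fun _ : V => ν) {i} E σ / lmarginal (fun _ : V => ν) (insert i Δ) E σ) :=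
      fun σ => by rw [hr, (weight_regroup (hE0 σ) (hEt σ)).1, hJG]
    simp_rw [hpt]
    have hdep : DependsOn (fun σ => lmarginal (fun _ : V => ν) {i} E σ /
        lmarginal (fun _ : V => ν) (insert i Δ) E σ) ((↑({i} : Finset V) : Set V)ᶜ) := by
      intro x y hxy
      show _ / _ = _ / _
      rw [dependsOn_compl_lmarginal (fun _ : V => ν) {i} E hxy,
        (dependsOn_compl_lmarginal (fun _ : V => ν) (insert i Δ) E).mono
          (Set.compl_subset_compl.2 (Finset.coe_subset.2 hsubi)) hxy]
    rw [lmarginal_mul_of_dependsOn_right _ {i}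
        (F := lmarginal (fun _ : V => ν) Δ (fun τ => E τ * A.indicator 1 τ)) hdep
        ((hEm.fun_mul hind).lmarginal _) η,
      hunion₁ (hEm.fun_mul hind)]
    -- `(X * (b / z)) / b = X / z`
    have hb0 := hJ0 {i} η
    have hbt := hJt {i} η
    calc lmarginal (fun _ : V => ν) (insert i Δ) (fun σ => E σ * A.indicator 1 σ) η *
          (lmarginal (fun _ : V => ν) {i} E η / lmarginal (fun _ : V => ν) (insert i Δ) E η) /
          lmarginal (fun _ : V => ν) {i} E η
        = lmarginal (fun _ : V => ν) {i} E η * (lmarginal (fun _ : V => ν) {i} E η)⁻¹ *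
            (lmarginal (fun _ : V => ν) (insert i Δ) (fun σ => E σ * A.indicator 1 σ) η /
              lmarginal (fun _ : V => ν) (insert i Δ) E η) := by
          simp only [div_eq_mul_inv]; ring
      _ = _ := by rw [ENNReal.mul_inv_cancel hb0 hbt, one_mul]
  -- (b) `γ_Δ(r G)(η) = G η`
  have hb : ∀ η, ∫⁻ σ, r σ * G σ ∂(((Measure.pi fun _ : Δ => ν).map (glueWith Δ · η)).tilted
      (φ Δ)) = G η := fun η => by
    rw [hKΔ η hrGm]
    have hpt : ∀ σ, E σ * (r σ * G σ) = lmarginal (fun _ : V => ν) {i} E σ *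
        (lmarginal (fun _ : V => ν) Δ E σ * G σ / lmarginal (fun _ : V => ν) (insert i Δ) E σ) :=
      fun σ => by rw [hr, (weight_regroup (hE0 σ) (hEt σ)).2]
    simp_rw [hpt]
    have hdep : DependsOn (fun σ => lmarginal (fun _ : V => ν) Δ E σ * G σ /
        lmarginal (fun _ : V => ν) (insert i Δ) E σ) ((↑Δ : Set V)ᶜ) := by
      intro x y hxy
      show _ * _ / _ = _ * _ / _
      rw [dependsOn_compl_lmarginal (fun _ : V => ν) Δ E hxy, hGdep hxy,
        (dependsOn_compl_lmarginal (fun _ : V => ν) (insert i Δ) E).mono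
          (Set.compl_subset_compl.2 (Finset.coe_subset.2 hsubΔ)) hxy]
    rw [lmarginal_mul_of_dependsOn_right _ Δ hdep (hJm {i}) η, hunion₂ hEm,
      ENNReal.mul_div_cancel (hJ0 _ η) (hJt _ η), mul_comm,
      ENNReal.mul_div_cancel_right (hJ0 Δ η) (hJt Δ η)]
  -- kernel measurability and the DLR equations for observables
  have hmeas : ∀ (Λ : Finset V) (B : Set (V → S)), MeasurableSet B → Measurable fun η =>
      ((Measure.pi fun _ : Λ => ν).map (glueWith Λ · η)).tilted (φ Λ) B := fun Λ B hB =>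
    (measurable_cylinderEvents_tilted_map_glueWith_pi_apply ν Λ (hφm Λ) (hφb Λ) hB).mono
      cylinderEvents_le_pi le_rfl
  -- the chain
  calc ∫⁻ η, ((Measure.pi fun _ : ↥(insert i Δ) => ν).map (glueWith (insert i Δ) · η)).tilted
          (φ (insert i Δ)) A ∂μ
      = ∫⁻ η, lmarginal (fun _ : V => ν) (insert i Δ) (fun σ => E σ * A.indicator 1 σ) η /
          lmarginal (fun _ : V => ν) (insert i Δ) E η ∂μ := by
        refine lintegral_congr fun η => ?_
        rw [← lintegral_indicator_one hA, hE,
          lintegral_tilted_map_glueWith_pi ν _ η (hφm _) (hφb _) hind]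
    _ = ∫⁻ η, ∫⁻ σ, r σ * G σ ∂(((Measure.pi fun _ : ({i} : Finset V) => ν).map
          (glueWith {i} · η)).tilted (φ {i})) ∂μ := lintegral_congr fun η => (ha η).symm
    _ = ∫⁻ η, r η * G η ∂μ := lintegral_lintegral_eq_of_forall_apply (hmeas {i}) hone hrGm
    _ = ∫⁻ η, ∫⁻ σ, r σ * G σ ∂(((Measure.pi fun _ : Δ => ν).map (glueWith Δ · η)).tilted
          (φ Δ)) ∂μ := (lintegral_lintegral_eq_of_forall_apply (hmeas Δ) hΔ hrGm).symm
    _ = ∫⁻ η, G η ∂μ := lintegral_congr fun η => hb η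
    _ = μ A := by rw [hG]; exact hΔ A hA

end Step

/-! ### Georgii's Theorem 1.33 -/

/-- **The one-site DLR equations characterise the Gibbs measures of a positive Gibbsian
specification** (Georgii 2011, Thm. 1.33, for the kernels
`γ_Λ(· | η) = (ν^{⊗Λ} ⊗ δ_{η_{Λᶜ}}).tilted φ_Λ` with a nonzero finite a priori measure `ν` and
bounded measurable energies `φ_Λ` such that `φ_{Λ'} - φ_Λ` does not depend on the spins in `Λ` for
`Λ ⊆ Λ'`): a probability measure `μ` with `∫ γ_{x}(A | η) dμ(η) = μ(A)` for every single site `x`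
and every measurable `A` is a Gibbs measure, `μ ∈ 𝒢(γ)`. (The converse is trivial; positivity of
the Boltzmann densities `e^{φ_Λ}` is what makes the one-site equations sufficient.)
[cite: Georgii2011, Thm. 1.33] -/
theorem isGibbsMeasure_tilted_of_singleton (ν : Measure S) [IsFiniteMeasure ν] [NeZero ν]
    {φ : Finset V → (V → S) → ℝ} (hφm : ∀ Λ, Measurable (φ Λ))
    (hφb : ∀ Λ, ∃ C, ∀ σ, |φ Λ σ| ≤ C)
    (hloc : ∀ ⦃Λ Λ' : Finset V⦄, Λ ⊆ Λ' → DependsOn (fun σ => φ Λ' σ - φ Λ σ) ((↑Λ : Set V)ᶜ))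
    {μ : Measure (V → S)} [IsProbabilityMeasure μ]
    (hone : ∀ (x : V) (A : Set (V → S)), MeasurableSet A →
      ∫⁻ η, ((Measure.pi fun _ : ({x} : Finset V) => ν).map (glueWith {x} · η)).tilted (φ {x}) A ∂μ
        = μ A) :
    IsGibbsMeasure
      (fun Λ η => ((Measure.pi fun _ : Λ => ν).map (glueWith Λ · η)).tilted (φ Λ)) μ := by
  refine ⟨inferInstance, fun Λ => ?_⟩
  induction Λ using Finset.induction_on with
  | empty =>
    intro A hA
    have hw : Measurable fun σ : V → S => ENNReal.ofReal (Real.exp (φ ∅ σ)) :=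
      (hφm ∅).exp.ennreal_ofReal
    calc ∫⁻ η, ((Measure.pi fun _ : ↥(∅ : Finset V) => ν).map (glueWith ∅ · η)).tilted (φ ∅) A ∂μ
        = ∫⁻ η, A.indicator 1 η ∂μ := by
          refine lintegral_congr fun η => ?_
          rw [tilted_map_glueWith_pi_apply ν ∅ η (hφm ∅) (hφb ∅) hA, lmarginal_empty,
            lmarginal_empty, mul_comm,
            ENNReal.mul_div_cancel_right (ENNReal.ofReal_ne_zero_iff.2 (Real.exp_pos _))
              ENNReal.ofReal_ne_top]
      _ = μ A := lintegral_indicator_one hA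
  | insert i Δ hi ih =>
    intro A hA
    exact dlr_insert_tilted ν hφm hφb hloc hi ih (hone i) hA

/-- **Georgii's Theorem 1.33 as an equivalence**: for the positive Gibbsian kernels above, a
probability measure is a Gibbs measure iff it satisfies the one-site DLR equations.
[cite: Georgii2011, Thm. 1.33] -/
theorem isGibbsMeasure_tilted_iff_singleton (ν : Measure S) [IsFiniteMeasure ν] [NeZero ν]
    {φ : Finset V → (V → S) → ℝ} (hφm : ∀ Λ, Measurable (φ Λ))
    (hφb : ∀ Λ, ∃ C, ∀ σ, |φ Λ σ| ≤ C)
    (hloc : ∀ ⦃Λ Λ' : Finset V⦄, Λ ⊆ Λ' → DependsOn (fun σ => φ Λ' σ - φ Λ σ) ((↑Λ : Set V)ᶜ))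
    {μ : Measure (V → S)} [IsProbabilityMeasure μ] :
    IsGibbsMeasure
        (fun Λ η => ((Measure.pi fun _ : Λ => ν).map (glueWith Λ · η)).tilted (φ Λ)) μ ↔
      ∀ (x : V) (A : Set (V → S)), MeasurableSet A →
        ∫⁻ η, ((Measure.pi fun _ : ({x} : Finset V) => ν).map (glueWith {x} · η)).tilted (φ {x}) A
          ∂μ = μ A :=
  ⟨fun h x A hA => h.2 {x} A hA, isGibbsMeasure_tilted_of_singleton ν hφm hφb hloc⟩

/-! ### Georgii's Theorem 1.33 for the Gibbsian specification of a potential -/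

/-- **Georgii's Theorem 1.33 for the Gibbsian specification of a potential**
`gibbsSpecOfPotential ν Φ supp β` (nonzero finite `ν`; adapted `Φ` with bounded terms supported by
`supp`; any real `β`): a probability measure satisfying the ONE-SITE DLR equations is a Gibbs
measure (`-β H_Λ` is bounded measurable and `H_{Λ'} - H_Λ` ignores the spins in `Λ`,
`dependsOn_hamiltonianIn_sub`; no countability needed). [cite: Georgii2011, Thm. 1.33] -/
theorem isGibbsMeasure_gibbsSpecOfPotential_of_singleton (ν : Measure S) [IsFiniteMeasure ν]
    [NeZero ν] {Φ : Potential V S} (hΦ : Φ.IsAdapted) (hΦb : ∀ A, ∃ C, ∀ σ, |Φ A σ| ≤ C)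
    {supp : Finset V → Finset (Finset V)} (hsupp : Φ.IsSupportedBy supp) (β : ℝ)
    {μ : Measure (V → S)} [IsProbabilityMeasure μ]
    (hone : ∀ (x : V) (A : Set (V → S)), MeasurableSet A →
      ∫⁻ η, gibbsSpecOfPotential ν Φ supp β {x} η A ∂μ = μ A) :
    IsGibbsMeasure (gibbsSpecOfPotential ν Φ supp β) μ := by
  choose C hC using hΦb
  unfold gibbsSpecOfPotential at hone ⊢
  exact isGibbsMeasure_tilted_of_singleton ν
    (fun Λ => (measurable_hamiltonianIn (fun A => (hΦ A).2) supp Λ).const_mul _)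
    (fun Λ => ⟨|β| * ∑ A ∈ supp Λ with (A ∩ Λ).Nonempty, C A, fun σ => by
      rw [abs_mul, abs_neg]
      exact mul_le_mul_of_nonneg_left (abs_hamiltonianIn_le hC supp Λ σ) (abs_nonneg β)⟩)
    (fun Λ Λ' h x y hxy => by
      have := dependsOn_hamiltonianIn_sub hΦ hsupp h hxy
      simp only at this ⊢
      rw [← mul_sub, ← mul_sub, this])
    hone

/-- **Georgii's Theorem 1.33 for `gibbsSpecOfPotential`, as an equivalence**: Gibbs iff the
one-site DLR equations hold (probability measures). [cite: Georgii2011, Thm. 1.33] -/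
theorem isGibbsMeasure_gibbsSpecOfPotential_iff_singleton (ν : Measure S) [IsFiniteMeasure ν]
    [NeZero ν] {Φ : Potential V S} (hΦ : Φ.IsAdapted) (hΦb : ∀ A, ∃ C, ∀ σ, |Φ A σ| ≤ C)
    {supp : Finset V → Finset (Finset V)} (hsupp : Φ.IsSupportedBy supp) (β : ℝ)
    {μ : Measure (V → S)} [IsProbabilityMeasure μ] :
    IsGibbsMeasure (gibbsSpecOfPotential ν Φ supp β) μ ↔
      ∀ (x : V) (A : Set (V → S)), MeasurableSet A →
        ∫⁻ η, gibbsSpecOfPotential ν Φ supp β {x} η A ∂μ = μ A :=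
  ⟨fun h x A hA => h.2 {x} A hA,
    isGibbsMeasure_gibbsSpecOfPotential_of_singleton ν hΦ hΦb hsupp β⟩

end Literature.Probability.LatticeModels
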